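import Mathlib
import Literature.Analysis.FluidPDE.Tao2016AveragedNS.ShiftSetCascadeFlows
import Literature.Analysis.ODE.ElementaryFieldChainCertificate
import Summits.NavierStokesRegularity.NavierStokesRegularity.Theorems.TaoLadderRungTwoFlatCertificateGlueMajorantStepOn
import Summits.NavierStokesRegularity.NavierStokesRegularity.Theorems.TaoLadderRungTwoFlatCertificateGlueFlowStepGenOn
import HarnessLib

/-!
# Certificate glue on a shift set `𝕊`, XX: BRIDGE TO THE TREE'S KERNEL ODE VERIFIERS — `StepCert` from an
  elementary-field chain CLAIM (`Literature.Analysis.ODE.EChainInstance.Claim`) for a code-list presentation of the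
  truncated window field (helper for items stmt-NavierStokesRegularity-22987 `FlatGapCertificatesV2` and stmt-24295
  K_A₂(64); cell harvest/h2-tao-ladder, p1 g14)

The Literature tree already holds SOUND, DECIDABLE validated-integration checkers for ODEs given by CODE LISTS
(`Literature/Analysis/ODE/ElementaryField{Enclosure,Chain,Variational,DoubletonChain}Certificate*.lean`,
`eChainVerifier`, `eDoubletonChainVerifier(S)`: Taylor / mean-value / C¹-Lohner doubleton chains over
`NonemptyInterval ℚ`, replayed by `decide`; pendulum, Lorenz and CAPD swing-equation transcripts in the tree). Their
output is `EChainInstance.Claim`: from every point of a rational box `init` a solution of `ẏ = f(y)` exists on `[0,T]`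
and EVERY solution from such a point has `y(T) ∈ final`. This module turns such a claim — for ANY code list `fld`
whose evaluation is the weighted truncated window field `QcN` (`hfld`) — into the ONE-STEP CERTIFICATE `StepCert j` of
glue X: node `j` = cascade states whose weighted window coordinates `xcoordC` lie in `init`, hull = the Cauchy-majorant
ball (glue XVI supplies the exact solution and the hull; the claim supplies the landing), next node ⊇ the `final` box
fattened by the Grönwall input allowance `A·ω` (glue XIV-b). Hence: THE EXISTING VERIFIED CHECKERS CAN DISCHARGE THE
DYNAMICAL CONTENT OF THE A♭ / A₂(64) CHAINS, given (i) a code list for the window field with `hfld`, (ii) transcripts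
accepted by their `check`, (iii) the table bound `b`, input defect `δ` and allowance `A` of glue XV/XVII.

HONEST FRAMING: Tao-type MODEL lattices; `Claim` is a HYPOTHESIS here (no transcript for the window systems exists in
the tree); nothing is certified, no stub is closed, nothing about the Navier–Stokes equations.
-/

noncomputable section

-- the sub-problem namespace repeats the summit name by design (D-0017)
set_option linter.dupNamespace false

namespace Summit.NavierStokesRegularity.NavierStokesRegularity.Theorems

open Set Finset Literature.Analysis.FluidPDE Literature.Analysis.FluidPDE.TaoCascade
open Literature.Analysis.ODE Literature.Analysis.ODE.FExpr

namespace CertificateGlueOn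

variable {m : ℕ} {𝕊 : Finset (ℤ × ℤ × ℤ)} {ε₀ : ℝ} {α : Fin m → Fin m → Fin m → ℤ × ℤ × ℤ → ℝ} {Kb Ka : ℤ}
  {Eb Et : ℝ} {ω : ℤ → ℝ}

/-- Weighted window coordinates of a cascade state on `Fin (m·W)` (through `finProdFinEquiv`). [folklore] -/
def xcoordC (Kb Ka : ℤ) (ω : ℤ → ℝ) (z : Fin m → ℤ → ℝ) : Fin (m * winLen Kb Ka) → ℝ :=
  fun d => wcoord Kb Ka ω z (finProdFinEquiv.symm d)

/-- `xcoordC` composed with the index equivalence is `wcoord`. [folklore] -/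
theorem xcoordC_comp (z : Fin m → ℤ → ℝ) :
    xcoordC Kb Ka ω z ∘ (finProdFinEquiv : Fin m × Fin (winLen Kb Ka) ≃ Fin (m * winLen Kb Ka)) =
      wcoord Kb Ka ω z := by
  funext c; simp [xcoordC]

/-- `biFieldOn` reads only the window: replacing a state by `wstate (wcoord ·)` changes nothing. [folklore] -/
theorem biFieldOn_wstate_wcoord (hω : ∀ k, 0 < ω k) (Y : Fin m → ℤ → ℝ) :
    biFieldOn 𝕊 ε₀ α Kb Ka (wstate Kb Ka ω (wcoord Kb Ka ω Y)) (wstate Kb Ka ω (wcoord Kb Ka ω Y)) =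
      biFieldOn 𝕊 ε₀ α Kb Ka Y Y := by
  have ht : truncAt Kb Ka (wstate Kb Ka ω (wcoord Kb Ka ω Y)) = truncAt Kb Ka Y := by
    funext i n
    unfold truncAt
    split_ifs with hn
    · exact wstate_wcoord hω Y i hn.1 hn.2
    · rfl
  funext i k
  simp only [biFieldOn, ht]

/-- **`StepCert` FROM AN ELEMENTARY-FIELD CHAIN CLAIM** (see the module docstring).
[cite: Moore1979, §8.1 eq. (8.13) (validated integration claim); cell certificate format, bridge to the tree's ODE verifiers] -/
theorem stepCert_of_claim (hKb : 0 ≤ Kb) (hKa : 1 ≤ Ka) (hε : 0 < 1 + ε₀) (hω : ∀ k, 0 < ω k)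
    {M : ℤ → ℝ} {t : ℕ → ℝ} {Node Hull : ℕ → (Fin m → ℤ → ℝ) → Prop} {j : ℕ}
    {b m₀ R δ A : ℝ} (hb : 0 ≤ b) (hm₀ : 0 ≤ m₀) (hδ : 0 ≤ δ)
    (hh : 0 ≤ t (j + 1) - t j) (hguard : b * m₀ * (t (j + 1) - t j) < 1)
    (hB : ∀ i k, -Kb ≤ k → k ≤ Ka →
      ∑ i₁ : Fin m, ∑ i₂ : Fin m, ∑ μ ∈ 𝕊,
        |α i₁ i₂ i μ| * (1 + ε₀) ^ ((5 : ℝ) * (k - μ.2.2) / 2) *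
          (wExt Kb Ka ω (k - μ.2.2 + μ.1) * wExt Kb Ka ω (k - μ.2.2 + μ.2.1)) ≤ b * ω k)
    -- the code list and its identification with the weighted truncated window field
    {fld : Fin (m * winLen Kb Ka) → FExpr (m * winLen Kb Ka)}
    (hfld : ∀ x : Fin (m * winLen Kb Ka) → ℝ, fieldFun fld x = QcN 𝕊 ε₀ α Kb Ka ω x x)
    -- the claim of the tree's verifiers for the step
    {init final : Fin (m * winLen Kb Ka) → NonemptyInterval ℚ} {T : ℚ} (hT : (T : ℝ) = t (j + 1) - t j)
    (hclaim : EChainInstance.Claim ⟨fld, init, T, final⟩)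
    -- node j inside the initial box and inside the weighted ball of radius m₀; region and inputs
    (hN : ∀ y, Node j y → xcoordC Kb Ka ω y ∈ boxSet (castBox init))
    (hNm : ∀ y, Node j y → ∀ i k, -Kb ≤ k → k ≤ Ka → |y i k| ≤ m₀ * ω k)
    (hR : m₀ / (1 - b * m₀ * (t (j + 1) - t j)) ≤ R) (hMR : ∀ k, -Kb ≤ k → k ≤ Ka → M k ≤ R * ω k)
    (hdef : InputDefectOn 𝕊 ε₀ α Kb Ka Eb Et ω (fun _ k => -(R * ω k)) (fun _ k => R * ω k) δ)
    (hA : gronwallBound 0 (2 * b * R) δ (t (j + 1) - t j) ≤ A)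
    (hH : ∀ y : Fin m → ℤ → ℝ,
      (∀ i k, -Kb ≤ k → k ≤ Ka → |y i k| ≤ (m₀ / (1 - b * m₀ * (t (j + 1) - t j)) + A) * ω k) → Hull j y)
    (hN' : ∀ y p : Fin m → ℤ → ℝ, xcoordC Kb Ka ω p ∈ boxSet (castBox final) →
      (∀ i k, -Kb ≤ k → k ≤ Ka → |y i k - p i k| ≤ A * ω k) → Node (j + 1) y) :
    StepCert 𝕊 ε₀ α Kb Ka Eb Et M t Node Hull j := by
  have hKK : 0 ≤ Ka + Kb + 1 := by omega
  set h := t (j + 1) - t j with hhdef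
  set m₁ := m₀ / (1 - b * m₀ * h) with hm₁
  have hden : 0 < 1 - b * m₀ * h := by linarith
  have hm₁0 : 0 ≤ m₁ := div_nonneg hm₀ hden.le
  have hR0 : 0 ≤ R := hm₁0.trans hR
  have hmaj : ∀ u ∈ Icc 0 h, m₀ / (1 - b * m₀ * u) ≤ m₁ := by
    intro u hu
    exact div_le_div_of_nonneg_left hm₀ hden (by nlinarith [mul_nonneg hb hm₀, hu.2])
  refine stepCert_of_flowStep'
    (Start := fun z => xcoordC Kb Ka ω z ∈ boxSet (castBox init) ∧ ∀ i k, -Kb ≤ k → k ≤ Ka → |z i k| ≤ m₀ * ω k)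
    (Land := fun p => xcoordC Kb Ka ω p ∈ boxSet (castBox final))
    (Hlo := fun _ k => -(m₁ * ω k)) (Hhi := fun _ k => m₁ * ω k)
    (glo := fun _ k => -(R * ω k)) (ghi := fun _ k => R * ω k)
    hKb hKa hω (by positivity : 0 ≤ 2 * b * R) hδ (fun y hy => ⟨hN y hy, hNm y hy⟩)
    (fun i k hk1 hk2 => ?_) (fun i k hk1 hk2 => ?_) (fieldLipOn_ball hε hω hR0 hB) hdef (fun z hz => ?_) hA
    (fun y hy => hH y fun i k hk1 hk2 => ?_) (fun y p hp hnear => hN' y p hp hnear)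
  · have := hMR k hk1 hk2
    exact ⟨by linarith, this⟩
  · have : m₁ * ω k ≤ R * ω k := mul_le_mul_of_nonneg_right hR (hω k).le
    exact ⟨by linarith, this⟩
  · -- exact flow from `z` (glue XVI), majorant hull, landing by the CLAIM
    obtain ⟨hzbox, hzm⟩ := hz
    obtain ⟨ψ, hψ0, hψd, hψb⟩ := exists_truncFlow_majorant (𝕊 := 𝕊) (ε₀ := ε₀) (α := α) hKb hKa hε hω hb hB
      hm₀ hzm hh hguard
    refine ⟨ψ, hψ0, hψd, fun u hu i k hk1 hk2 => ?_, ?_⟩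
    · have h1 := hψb u hu i k hk1 hk2
      have h2 : m₀ / (1 - b * m₀ * u) * ω k ≤ m₁ * ω k := mul_le_mul_of_nonneg_right (hmaj u hu) (hω k).le
      simp only [slice_apply]
      exact abs_le.mp (h1.trans h2)
    · -- the coordinate trajectory solves the code-list ODE; the claim lands it in `final`
      set y : ℝ → Fin (m * winLen Kb Ka) → ℝ := fun u => xcoordC Kb Ka ω (slice ψ u) with hy
      have hy0 : y 0 = xcoordC Kb Ka ω z := by
        funext d
        obtain ⟨h1, h2⟩ := shellAt_mem hKK (finProdFinEquiv.symm d).2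
        have e1 := hψ0 (finProdFinEquiv.symm d).1 _ h1 h2
        simp only [hy, xcoordC, wcoord, slice_apply, e1]
      have hyd : ∀ u ∈ Icc 0 (T : ℝ), HasDerivWithinAt y (fieldFun fld (y u)) (Icc 0 (T : ℝ)) u := by
        intro u hu
        rw [hT] at hu ⊢
        rw [hasDerivWithinAt_pi]
        intro d
        obtain ⟨h1, h2⟩ := shellAt_mem hKK (finProdFinEquiv.symm d).2
        set c := finProdFinEquiv.symm d with hc
        have hcomp := (hψd c.1 _ h1 h2 u hu).div_const (ω (shellAt Kb c.2))
        have hval : fieldFun fld (y u) d =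
            truncField 𝕊 ε₀ α Kb Ka (slice ψ u) c.1 (shellAt Kb c.2) / ω (shellAt Kb c.2) := by
          rw [hfld]
          simp only [QcN, Qc, hy]
          rw [xcoordC_comp, biFieldOn_wstate_wcoord hω]
          simp only [wcoord, ← hc, truncField_eq_biFieldOn]
        rw [hval]
        have : (fun x => y x d) = fun x => ψ c.1 (shellAt Kb c.2) x / ω (shellAt Kb c.2) := by
          funext x; simp [hy, xcoordC, wcoord, hc]
        rw [this]
        exact hcomp
      have hland := (hclaim (xcoordC Kb Ka ω z) hzbox).2 y hy0 hyd
      show xcoordC Kb Ka ω (slice ψ h) ∈ boxSet (castBox final)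
      have : slice ψ h = slice ψ (T : ℝ) := by rw [hT]
      rw [this]
      exact hland
  · have := hy i k hk1 hk2
    rw [abs_le]
    constructor <;> nlinarith [this.1, this.2, (hω k).le]

end CertificateGlueOn

end Summit.NavierStokesRegularity.NavierStokesRegularity.Theorems

end
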